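import Summits.BirchSwinnertonDyer.BirchSwinnertonDyer.Theorems.ByReductionTypeAtTwoGoodOrdTowerControlLayerBoundP
import Literature.NumberTheory.EllipticCurves.IwasawaSelmerControlOfLayerKernelsProofs
import Literature.NumberTheory.EllipticCurves.IwasawaSelmerControlProofs
import HarnessLib

/-!
# Route `ByReductionTypeAtTwo`, item `OrdKatoHalfAtTwo` (stmt-BirchSwinnertonDyer-19271), TOWER road: MAZUR'S CONTROL
# THEOREM over `ℚ` at EVERY prime `p`, CONDITIONAL on Tate's local Euler–Poincaré characteristic formula for `ℚ_p`
# (named fact `localEulerPoincareCharacteristic`) — the unconditional `p = 2` case is `…GoodOrdTowerControl.lean`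

HONEST FRAMING (cell `bsd-2adic`, run/shared/lean/pub/bsd-2adic/, seat `bsd-2adic-tower-1` GEN 20, HUMAN RULINGS
D-0036 / D-0054 / D-0074): theorems only (no definition, no named fact, no `sorry`, axioms the standard trio); closes no
route item by itself; nothing booked; BSD is not proved by any of this. CONDITIONAL companion (all `p`) of `…GoodOrdTowerControl.lean`. WHAT IT PROVES (modulo the named fact `localEulerPoincareCharacteristic ℚ_v`, Tate's local Euler–Poincaré characteristic formula, Milne ADT I Thm. 2.8 — a TREE THEOREM since 2026-08-21,
`Literature.NumberTheory.GaloisRepresentations.localEulerPoincareCharacteristic_holds` (module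
`Summits/…/Rank1Residual/GaloisImage/LocalEulerPoincareCharacteristicHolds`); the hypothesis of this file is DISCHARGED by name in
`…GoodOrdTowerControlAllP.lean` (GEN 21; doc corrected GEN 23 — the earlier parenthesis «proved only for μ_n, trivial coefficients
and the dévissage step» was stale): the tree's named PREDICATES
`WeierstrassCurve.Greenberg1999_kerG_bounded κ` (Greenberg, LNM 1716, §3 Lemma 3.5) and `WeierstrassCurve.selmer_control κ`
(MAZUR'S CONTROL THEOREM, Greenberg Thm. 1.2 / Mazur 1972: for `E/ℚ` with good ordinary reduction at `p` and the cyclotomic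
`ℤ_p`-extension, the maps `Sel_{p^∞}(E/ℚ_n) → Sel_{p^∞}(E/ℚ_∞)^{Γ_n}` have finite kernels and cokernels of order bounded
independently of `n`) HOLD for every globally minimal `W/ℚ`, every prime `p` and every `κ : ZpExtension ℚ p`, PROVIDED Tate's
local Euler–Poincaré formula holds for `ℚ_v`, `v ∣ p`. This trades the curve-specific print binder
`Greenberg1999.lemma34_natCard_localTowerKerPrimary_eq_rat` (Greenberg's Lemma 3.4 at the layers, `…_of_lemma34`) for a
standard theorem of local Galois cohomology; the only use of it is the Euler–Poincaré count of the formal-group torsion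
`Ê[p^k]` induced from the layer group to `Γ_{ℚ_v}` (BRICK F); at `p = 2` that count is unconditional (BRICKS C/C′) and so is
`selmer_control_two`.

* `Greenberg1999_kerG_bounded_of_localEP` — `(∀ v ∣ p, localEulerPoincareCharacteristic ℚ_v) → W.Greenberg1999_kerG_bounded κ`
  for `W/ℚ` globally minimal, any prime `p`, `κ : ZpExtension ℚ p`.
* `selmer_control_of_localEP` — **Mazur's control theorem `W.selmer_control κ` at every `p`, modulo Tate's local Euler–Poincaré
  formula** (CONDITIONAL result: the gate records the named-fact hypothesis; at `p = 2` see the unconditional `selmer_control_two`).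

References: B. Mazur, *Rational points of abelian varieties with values in towers of number fields*, Invent. Math. 18 (1972),
§6; R. Greenberg, *Iwasawa theory for elliptic curves*, LNM 1716 (1999), Thm. 1.2 (pp. 59–60), Thm. 1.4, §3 Lemmas 3.1–3.5
(pp. 86–90); J. Milne, *ADT* (2006), I §2–3.
-/

set_option autoImplicit false
-- the Theorems namespace of this sub repeats the summit name by design (D-0017 nested layout: Summit.<S>.<Sub>)
set_option linter.dupNamespace false

noncomputable section

open scoped Classical

namespace Summit.BirchSwinnertonDyer.BirchSwinnertonDyer.Theorems.GoodOrdTower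

open NumberField IsDedekindDomain Literature.NumberTheory.EllipticCurves Literature.NumberTheory.GaloisRepresentations
  Literature.NumberTheory.EllipticCurves.Rank1Residual WeierstrassCurve

/-- **Greenberg's Lemma 3.5 at every prime, modulo Tate's local Euler–Poincaré formula**: for `W/ℚ` globally minimal,
`p` prime and `κ : ZpExtension ℚ p`, if `localEulerPoincareCharacteristic ℚ_v` holds at the place `v ∣ p` then the named
predicate `W.Greenberg1999_kerG_bounded κ` holds. Proof: `Greenberg1999_kerG_bounded_of_atP_layerBounds` fed with
`exists_natCard_localTowerKerPrimary_le_of_localEP`. [cite: GreenbergLNM1716, §3 Lemma 3.5 (p. 90) with Lemma 3.4 (p. 89)]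
[cite: MilneADT2006, I Thm. 2.8] -/
theorem Greenberg1999_kerG_bounded_of_localEP {p : ℕ} [Fact p.Prime] (W : WeierstrassCurve ℚ) [W.IsGloballyMinimal]
    (κ : ZpExtension ℚ p)
    (hEP : ∀ v : HeightOneSpectrum (𝓞 ℚ), ((p : ℕ) : 𝓞 ℚ) ∈ v.asIdeal → localEulerPoincareCharacteristic (v.adicCompletion ℚ)) :
    W.Greenberg1999_kerG_bounded κ := by
  refine W.Greenberg1999_kerG_bounded_of_atP_layerBounds κ fun hκ hp' v hpv ↦ ?_
  obtain ⟨hgood, hunit⟩ := hp' v hpv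
  have hgo : GoodOrd W p :=
    ⟨W.hasGoodReductionAtPrime_of_hasGoodReductionAt v hpv hgood,
      (W.hasUnitRootAt_iff_not_dvd_frobeniusTrace v Fact.out hpv).mp hunit⟩
  exact exists_natCard_localTowerKerPrimary_le_of_localEP W hgo κ hκ v hpv (hEP v hpv)

/-- **MAZUR'S CONTROL THEOREM over `ℚ` at every prime, modulo Tate's local Euler–Poincaré formula** (Greenberg, LNM 1716,
Thm. 1.2; Mazur 1972): for `W/ℚ` globally minimal, `p` prime, `κ : ZpExtension ℚ p`, if `localEulerPoincareCharacteristic ℚ_v`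
holds at `v ∣ p` then `W.selmer_control κ` — under good ordinary reduction at `p` and `κ` cyclotomic, the maps
`Sel_{p^∞}(E/ℚ_n) → Sel_{p^∞}(E/ℚ_∞)^{Γ_n}` have finite kernels and cokernels of bounded order. CONDITIONAL on the named fact
(Tate); unconditional at `p = 2` (`selmer_control_two`). [cite: GreenbergLNM1716, Thm 1.2 (pp. 59–60) and §3 (pp. 86–90)]
[cite: MazurInvent1972, §6] [cite: MilneADT2006, I Thm. 2.8] -/
theorem selmer_control_of_localEP {p : ℕ} [Fact p.Prime] (W : WeierstrassCurve ℚ) [W.IsGloballyMinimal] (κ : ZpExtension ℚ p)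
    (hEP : ∀ v : HeightOneSpectrum (𝓞 ℚ), ((p : ℕ) : 𝓞 ℚ) ∈ v.asIdeal → localEulerPoincareCharacteristic (v.adicCompletion ℚ)) :
    W.selmer_control κ :=
  W.selmer_control_of_kerG_bounded κ (Greenberg1999_kerG_bounded_of_localEP W κ hEP)

end Summit.BirchSwinnertonDyer.BirchSwinnertonDyer.Theorems.GoodOrdTower

end
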